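import Mathlib
import HarnessLib
import Summits.HubbardSuperconductivity.HubbardSuperconductivity.Theorems.KLProgrammeKLRegimeSplitFrameFnLemmas
import Summits.HubbardSuperconductivity.HubbardSuperconductivity.Theorems.KLProgrammeKLRegimeSplitPredicatesV3
import Summits.HubbardSuperconductivity.HubbardSuperconductivity.Theorems.KLProgrammeNonCooperKernelsDefs

/-!
# Route `KLProgramme`, crux K3 — Δ23 / (R-I) core, part 3: MODEL CONGRUENCE — the model reads a frame only through its
# LATTICE VALUES; hence `klLocalPartFn … K.eval = klLocalPart … K` (plan2 g3's (b★): the two-leg Fn texts at `K.eval` read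
# today's objects — no thin variants, no second bundle)

Cell gate-hubbard-kl, seat p2 (g6); continues `…KLRegimeSplitFrameFn` (p479563) and `…FrameFnLemmas` (p480434).  Every model object of the
KL programme is a function of `hubbardEffectiveActionCT L M β U μ h K Λ` and `nambuXiCT L μ K`, and these depend on the frame `K : TrigPolyC4v`
only through `k ↦ K.eval (latticeMomentum L k)` (`counterQuadratic`, `nambuXiCT`; `HubbardEffectiveActionCT` §2–§5).  §1 proves the congruence
chain at the Literature objects, §2 lifts it to the Summits-side objects (`klEffectiveAction`, sector families, leg kernels and norms, `klSelfEnergy`,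
`klLocSelfEnergyRe`, `klShell`, `klBall`, `klFieldStrength`, `klFermiMismatch`, `klPairAmplitude`, `klQuarticValue`, `klCooperAmplitude`, `klIsoArray`,
`klBGMNorm`), §3 applies it to the model's view `toTrigPoly L K.eval` of a `TrigPolyC4v` frame (same lattice values, `eval_toTrigPoly_latticeMomentum`):
**`klLocalPartFn L M β U μ K.eval n = klLocalPart L M β U μ K n`**, `RenormalisedAtFn … K.eval … ↔ RenormalisedAtF … K …`, so under (R-I-min) the
Fn two-leg clause texts instantiated at `K.eval` speak about today's `klLocalPart`-based objects verbatim.  Proofs only.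
-/

noncomputable section

namespace Summit.HubbardSuperconductivity.HubbardSuperconductivity.Theorems.KLRegimeSplit

set_option linter.dupNamespace false -- summit = problem name (single-conjunct summit), D-0017

open Real Finset Literature.MathematicalPhysics.QuantumLattice Literature.Probability.LatticeModels
open Literature.MathematicalPhysics.QuantumLattice.FermiRG
open Summit.HubbardSuperconductivity.HubbardSuperconductivity.Theorems.KLProgrammeLegKernels

/-! ## §1 The Literature objects -/

section Lit

variable (L M : ℕ) [NeZero L] {K K' : TrigPolyC4v}

omit [NeZero L] in
/-- Frames with the same lattice values have the same renormalised band. -/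
theorem nambuXiCT_congr (μ : ℝ) (hK : ∀ k : TorusSite 2 L, K.eval (latticeMomentum L k) = K'.eval (latticeMomentum L k)) :
    nambuXiCT L μ K = nambuXiCT L μ K' := by
  funext k; simp only [nambuXiCT, hK]

omit [NeZero L] in
/-- … the same Nambu denominators. -/
theorem nambuDenCT_congr (β μ h : ℝ) (hK : ∀ k : TorusSite 2 L, K.eval (latticeMomentum L k) = K'.eval (latticeMomentum L k)) :
    nambuDenCT L M β μ h K = nambuDenCT L M β μ h K' := by
  funext k; simp only [nambuDenCT, nambuXiCT_congr L μ hK]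

omit [NeZero L] in
/-- … the same Nambu propagators. -/
theorem nambuPropagatorCT_congr (β μ h : ℝ) (hK : ∀ k : TorusSite 2 L, K.eval (latticeMomentum L k) = K'.eval (latticeMomentum L k)) :
    nambuPropagatorCT L M β μ h K = nambuPropagatorCT L M β μ h K' := by
  funext k; simp only [nambuPropagatorCT, nambuXiCT_congr L μ hK, nambuDenCT_congr L M β μ h hK]

omit [NeZero L] in
/-- … the same Nambu two-point function. -/
theorem nambuTwoPointCT_congr (β μ h : ℝ) (hK : ∀ k : TorusSite 2 L, K.eval (latticeMomentum L k) = K'.eval (latticeMomentum L k)) :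
    nambuTwoPointCT L M β μ h K = nambuTwoPointCT L M β μ h K' := by
  funext X Y; simp only [nambuTwoPointCT, nambuPropagatorCT_congr L M β μ h hK]

omit [NeZero L] in
/-- … the same Hubbard two-point function. -/
theorem hubbardTwoPointCT_congr (β μ h : ℝ) (hK : ∀ k : TorusSite 2 L, K.eval (latticeMomentum L k) = K'.eval (latticeMomentum L k)) :
    hubbardTwoPointCT L M β μ h K = hubbardTwoPointCT L M β μ h K' := by
  funext X Y; simp only [hubbardTwoPointCT, nambuTwoPointCT_congr L M β μ h hK]

omit [NeZero L] in
/-- … the same covariance. -/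
theorem hubbardCovarianceCT_congr (β μ h : ℝ) (hK : ∀ k : TorusSite 2 L, K.eval (latticeMomentum L k) = K'.eval (latticeMomentum L k)) :
    hubbardCovarianceCT L M β μ h K = hubbardCovarianceCT L M β μ h K' := by
  simp only [hubbardCovarianceCT, hubbardTwoPointCT_congr L M β μ h hK]

omit [NeZero L] in
/-- … the same cutoff weights. -/
theorem hubbardCutoffWeightCT_congr (β μ Λ : ℝ) (hK : ∀ k : TorusSite 2 L, K.eval (latticeMomentum L k) = K'.eval (latticeMomentum L k)) :
    hubbardCutoffWeightCT L M β μ K Λ = hubbardCutoffWeightCT L M β μ K' Λ := by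
  funext k; simp only [hubbardCutoffWeightCT, nambuXiCT_congr L μ hK]

omit [NeZero L] in
/-- … the same covariance above scale `Λ`. -/
theorem hubbardCovAboveCT_congr (β μ h Λ : ℝ) (hK : ∀ k : TorusSite 2 L, K.eval (latticeMomentum L k) = K'.eval (latticeMomentum L k)) :
    hubbardCovAboveCT L M β μ h K Λ = hubbardCovAboveCT L M β μ h K' Λ := by
  simp only [hubbardCovAboveCT, hubbardCutoffWeightCT_congr L M β μ Λ hK, hubbardCovarianceCT_congr L M β μ h hK]

omit [NeZero L] in
/-- … the same covariance below scale `Λ`. -/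
theorem hubbardCovBelowCT_congr (β μ h Λ : ℝ) (hK : ∀ k : TorusSite 2 L, K.eval (latticeMomentum L k) = K'.eval (latticeMomentum L k)) :
    hubbardCovBelowCT L M β μ h K Λ = hubbardCovBelowCT L M β μ h K' Λ := by
  simp only [hubbardCovBelowCT, hubbardCovarianceCT_congr L M β μ h hK, hubbardCovAboveCT_congr L M β μ h Λ hK]

omit [NeZero L] in
/-- … the same covariance slices. -/
theorem hubbardCovSliceCT_congr (β μ h Λ Λ' : ℝ) (hK : ∀ k : TorusSite 2 L, K.eval (latticeMomentum L k) = K'.eval (latticeMomentum L k)) :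
    hubbardCovSliceCT L M β μ h K Λ Λ' = hubbardCovSliceCT L M β μ h K' Λ Λ' := by
  simp only [hubbardCovSliceCT, hubbardCovAboveCT_congr L M β μ h Λ hK, hubbardCovAboveCT_congr L M β μ h Λ' hK]

/-- … the same quadratic counterterm vertex. -/
theorem counterQuadratic_congr (β : ℝ) (hK : ∀ k : TorusSite 2 L, K.eval (latticeMomentum L k) = K'.eval (latticeMomentum L k)) :
    counterQuadratic L M β K = counterQuadratic L M β K' := by
  unfold counterQuadratic
  exact Finset.sum_congr rfl fun k _ => Finset.sum_congr rfl fun σ _ => by rw [hK]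

/-- … the same interaction. -/
theorem hubbardInteractionCT_congr (β U : ℝ) (hK : ∀ k : TorusSite 2 L, K.eval (latticeMomentum L k) = K'.eval (latticeMomentum L k)) :
    hubbardInteractionCT L M β U K = hubbardInteractionCT L M β U K' := by
  simp only [hubbardInteractionCT, counterQuadratic_congr L M β hK]

/-- **Frames with the same lattice values have the same Wilsonian effective action at every scale.** -/
theorem hubbardEffectiveActionCT_congr (β U μ h Λ : ℝ)
    (hK : ∀ k : TorusSite 2 L, K.eval (latticeMomentum L k) = K'.eval (latticeMomentum L k)) :
    hubbardEffectiveActionCT L M β U μ h K Λ = hubbardEffectiveActionCT L M β U μ h K' Λ := by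
  simp only [hubbardEffectiveActionCT_def, hubbardCovAboveCT_congr L M β μ h Λ hK, hubbardInteractionCT_congr L M β U hK]

/-- … and the same normalised partition function. -/
theorem hubbardEffPartitionFnCT_congr (β U μ h Λ : ℝ)
    (hK : ∀ k : TorusSite 2 L, K.eval (latticeMomentum L k) = K'.eval (latticeMomentum L k)) :
    hubbardEffPartitionFnCT L M β U μ h K Λ = hubbardEffPartitionFnCT L M β U μ h K' Λ := by
  simp only [hubbardEffPartitionFnCT, hubbardCovAboveCT_congr L M β μ h Λ hK, hubbardInteractionCT_congr L M β U hK]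

end Lit

/-! ## §2 The Summits-side objects of the KL programme -/

section KL

variable (L M : ℕ) [NeZero L] {K K' : TrigPolyC4v}
  (hK : ∀ k : TorusSite 2 L, K.eval (latticeMomentum L k) = K'.eval (latticeMomentum L k))
include hK

/-- Same lattice values ⇒ same scale-`n` effective action. -/
theorem klEffectiveAction_congr (β U μ e₀ : ℝ) (n : ℕ) :
    klEffectiveAction L M β U μ K e₀ n = klEffectiveAction L M β U μ K' e₀ n := by
  simp only [klEffectiveAction, hubbardEffectiveActionCT_congr L M β U μ 0 (klScale e₀ n) hK]

omit [NeZero L] in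
/-- Same lattice values ⇒ same isotropic sector multipliers. -/
theorem klIsoFamily_congr (β μ e₀ : ℝ) (n : ℕ) : klIsoFamily L M β μ K e₀ n = klIsoFamily L M β μ K' e₀ n := by
  simp only [klIsoFamily, nambuXiCT_congr L μ hK]

omit [NeZero L] in
/-- Same lattice values ⇒ same anisotropic sector multipliers. -/
theorem klAnisoFamily_congr (β μ e₀ : ℝ) (n : ℕ) : klAnisoFamily L M β μ K e₀ n = klAnisoFamily L M β μ K' e₀ n := by
  simp only [klAnisoFamily, nambuXiCT_congr L μ hK]

/-- Same lattice values ⇒ same isotropic leg kernels. -/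
theorem klLegKernel_congr (β U μ e₀ : ℝ) (n m : ℕ) : klLegKernel L M β U μ K e₀ n m = klLegKernel L M β U μ K' e₀ n m := by
  simp only [klLegKernel, klIsoFamily_congr L M hK, klEffectiveAction_congr L M hK]

/-- Same lattice values ⇒ same anisotropic leg kernels. -/
theorem klAnisoLegKernel_congr (β U μ e₀ : ℝ) (n m : ℕ) :
    klAnisoLegKernel L M β U μ K e₀ n m = klAnisoLegKernel L M β U μ K' e₀ n m := by
  simp only [klAnisoLegKernel, klAnisoFamily_congr L M hK, klEffectiveAction_congr L M hK]

/-- Same lattice values ⇒ same isotropic kernel norms. -/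
theorem klLegKernelNorm_congr (β U μ e₀ : ℝ) (n m : ℕ) :
    klLegKernelNorm L M β U μ K e₀ n m = klLegKernelNorm L M β U μ K' e₀ n m := by
  simp only [klLegKernelNorm, klIsoFamily_congr L M hK, klEffectiveAction_congr L M hK]

/-- Same lattice values ⇒ same anisotropic kernel norms. -/
theorem klAnisoLegKernelNorm_congr (β U μ e₀ : ℝ) (n m : ℕ) :
    klAnisoLegKernelNorm L M β U μ K e₀ n m = klAnisoLegKernelNorm L M β U μ K' e₀ n m := by
  simp only [klAnisoLegKernelNorm, klAnisoFamily_congr L M hK, klEffectiveAction_congr L M hK]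

/-- Same lattice values ⇒ same BGM norm. -/
theorem klBGMNorm_congr (β U μ e₀ : ℝ) (n : ℕ) (ρ : ℝ) : klBGMNorm L M β U μ K e₀ n ρ = klBGMNorm L M β U μ K' e₀ n ρ := by
  simp only [klBGMNorm, nambuXiCT_congr L μ hK, klEffectiveAction_congr L M hK]

/-- Same lattice values ⇒ same self-energy. -/
theorem klSelfEnergy_congr (β U μ e₀ : ℝ) (n : ℕ) : klSelfEnergy L M β U μ K e₀ n = klSelfEnergy L M β U μ K' e₀ n := by
  funext k σ; simp only [klSelfEnergy, klEffectiveAction_congr L M hK]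

/-- Same lattice values ⇒ same Cooper amplitude. -/
theorem klCooperAmplitude_congr [NeZero M] (β U μ e₀ : ℝ) (n : ℕ) :
    klCooperAmplitude L M β U μ K e₀ n = klCooperAmplitude L M β U μ K' e₀ n := by
  funext k k'; simp only [klCooperAmplitude, klEffectiveAction_congr L M hK]

/-- Same lattice values ⇒ same localised two-leg values. -/
theorem klLocSelfEnergyRe_congr [NeZero M] (β U μ : ℝ) (n : ℕ) : klLocSelfEnergyRe L M β U μ K n = klLocSelfEnergyRe L M β U μ K' n := by
  funext k; simp only [klLocSelfEnergyRe, klSelfEnergy_congr L M hK]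

/-- Same lattice values ⇒ same shells. -/
theorem klShell_congr (μ : ℝ) (n : ℕ) : klShell L μ K n = klShell L μ K' n := by
  simp only [klShell, nambuXiCT_congr L μ hK]

/-- Same lattice values ⇒ same ball. -/
theorem klBall_congr (μ : ℝ) : klBall L μ K = klBall L μ K' := by
  simp only [klBall, klShell_congr L hK]

/-- Same lattice values ⇒ same field strength. -/
theorem klFieldStrength_congr [NeZero M] (β U μ : ℝ) (n : ℕ) : klFieldStrength L M β U μ K n = klFieldStrength L M β U μ K' n := by
  funext k; simp only [klFieldStrength, klEffectiveAction_congr L M hK]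

/-- Same lattice values ⇒ same Fermi-curve mismatch. -/
theorem klFermiMismatch_congr [NeZero M] (β U μ : ℝ) (n : ℕ) : klFermiMismatch L M β U μ K n = klFermiMismatch L M β U μ K' n := by
  simp only [klFermiMismatch, nambuXiCT_congr L μ hK, klEffectiveAction_congr L M hK]

/-- Same lattice values ⇒ same pair amplitude. -/
theorem klPairAmplitude_congr [NeZero M] (β U μ : ℝ) (n : ℕ) : klPairAmplitude L M β U μ K n = klPairAmplitude L M β U μ K' n := by
  funext Q k k'; simp only [klPairAmplitude, klEffectiveAction_congr L M hK]

/-- Same lattice values ⇒ same quartic values. -/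
theorem klQuarticValue_congr [NeZero M] (β U μ : ℝ) (n : ℕ) : klQuarticValue L M β U μ K n = klQuarticValue L M β U μ K' n := by
  funext σ σ' k₁ k₂ k₃; simp only [klQuarticValue, klEffectiveAction_congr L M hK]

end KL

/-! ## §3 The model's view of a `TrigPolyC4v` frame, and (b★) -/

section View

variable (L M : ℕ) [NeZero L]

/-- The model's view `toTrigPoly L K.eval` of a `TrigPolyC4v` frame has the frame's lattice values. -/
theorem eval_toTrigPoly_eval_latticeMomentum (K : TrigPolyC4v) (k : TorusSite 2 L) :
    (toTrigPoly L K.eval).eval (latticeMomentum L k) = K.eval (latticeMomentum L k) :=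
  eval_toTrigPoly_latticeMomentum L (isSymmetricFrame_eval K) k

/-- The Fn Fermi point at `K.eval` is today's Fermi point. -/
theorem klFermiPointFn_eval (μ : ℝ) (K : TrigPolyC4v) : klFermiPointFn μ K.eval = klFermiPoint μ K := rfl

/-- **(b★) answered: the Fn local part at `K.eval` IS today's local part** — `klLocalPartFn L M β U μ K.eval n = klLocalPart L M β U μ K n`
(the model at the re-interpolated view equals the model at `K` by §1–§2; the reading point is the same). -/
theorem klLocalPartFn_eval [NeZero M] (β U μ : ℝ) (K : TrigPolyC4v) (n : ℕ) :
    klLocalPartFn L M β U μ K.eval n = klLocalPart L M β U μ K n := by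
  funext θ
  rw [klLocalPartFn, klLocalPart, klFermiPointFn_eval,
    klLocSelfEnergyRe_congr L M (eval_toTrigPoly_eval_latticeMomentum L K) β U μ n]

/-- Hence the Fn renormalisation predicate at `K.eval` is today's. -/
theorem renormalisedAtFn_eval_iff [NeZero M] (β U μ : ℝ) (K : TrigPolyC4v) (R : RenConsts) (n : ℕ) :
    RenormalisedAtFn L M β U μ K.eval R n ↔ RenormalisedAtF L M β U μ K R n := by
  simp only [RenormalisedAtFn, RenormalisedAtF, klLocalPartFn_eval]

/-- The Fn two-leg output `D_n` at `K.eval` is the de-interpolated G-extension of TODAY's local part. -/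
theorem klTwoLegPolyFn_eval [NeZero M] (β U μ : ℝ) (K : TrigPolyC4v) (n : ℕ) :
    klTwoLegPolyFn L M β U μ K.eval n = klFrameExtFn μ (klLocalPart L M β U μ K n) := by
  rw [klTwoLegPolyFn, klLocalPartFn_eval]

/-- Every model object at the view `toTrigPoly L K.eval` equals the object at `K` — e.g. the engine's slots: the scale-`n`
effective action. -/
theorem klEffectiveAction_toTrigPoly_eval (β U μ e₀ : ℝ) (K : TrigPolyC4v) (n : ℕ) :
    klEffectiveAction L M β U μ (toTrigPoly L K.eval) e₀ n = klEffectiveAction L M β U μ K e₀ n :=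
  klEffectiveAction_congr L M (eval_toTrigPoly_eval_latticeMomentum L K) β U μ e₀ n

/-- … the shells. -/
theorem klShell_toTrigPoly_eval (μ : ℝ) (K : TrigPolyC4v) (n : ℕ) : klShell L μ (toTrigPoly L K.eval) n = klShell L μ K n :=
  klShell_congr L (eval_toTrigPoly_eval_latticeMomentum L K) μ n

/-- … the field strength. -/
theorem klFieldStrength_toTrigPoly_eval [NeZero M] (β U μ : ℝ) (K : TrigPolyC4v) (n : ℕ) :
    klFieldStrength L M β U μ (toTrigPoly L K.eval) n = klFieldStrength L M β U μ K n :=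
  klFieldStrength_congr L M (eval_toTrigPoly_eval_latticeMomentum L K) β U μ n

/-- … the localised two-leg values. -/
theorem klLocSelfEnergyRe_toTrigPoly_eval [NeZero M] (β U μ : ℝ) (K : TrigPolyC4v) (n : ℕ) :
    klLocSelfEnergyRe L M β U μ (toTrigPoly L K.eval) n = klLocSelfEnergyRe L M β U μ K n :=
  klLocSelfEnergyRe_congr L M (eval_toTrigPoly_eval_latticeMomentum L K) β U μ n

/-- **The Fn slope clause at `K.eval` is today's slope clause with the Fn local part** (all three model reads coincide). -/
theorem twoLegSlopesFn_eval_iff [NeZero M] (R : RenConsts) (β U μ : ℝ) (K : TrigPolyC4v) (n : ℕ) :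
    TwoLegSlopesFn L M R β U μ K.eval n ↔ TwoLegSlopes L M R β U μ K n := by
  simp only [TwoLegSlopesFn, TwoLegSlopes, klShell_toTrigPoly_eval, klFieldStrength_toTrigPoly_eval,
    klLocSelfEnergyRe_toTrigPoly_eval, nambuXiCT_toTrigPoly_eval, klLocalPartFn_eval]

end View

end Summit.HubbardSuperconductivity.HubbardSuperconductivity.Theorems.KLRegimeSplit

end
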